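import Literature.Computability.AlgebraicComplexity.LinSubst
import HarnessLib

/-!
# Linear substitution does not raise the total degree: discharge

Sibling proofs file of `Literature/Computability/AlgebraicComplexity/LinSubst.lean`. It discharges
the named fact `Literature.Computability.AlgebraicComplexity.totalDegree_linSubst_le`
("linear substitution of variables `X i ↦ ∑ j, A j i • X j` does not raise the total degree of a
polynomial") as `totalDegree_linSubst_le_holds`, over an arbitrary commutative ring `k` and finite
index type `σ`, exactly as the fact is stated (no hypotheses added, nothing weakened).

## Source and proof

Landsberg 2017, §1.2.5 defines the action of `End(ℂ^N)` on the space `Sⁿℂ^N` of degree-`n`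
forms by `L · p(x) := p(Lᵀ x)` (the paragraph introducing `End(ℂ^{n²}) · p`, just before
eq. (1.2.4)); that this action lands in `Sⁿℂ^N` again is the statement that linear substitution
preserves homogeneity of each degree, vendored sorry-free as
`Literature.Computability.AlgebraicComplexity.linSubst_isHomogeneous`. The total-degree bound is
its inhomogeneous shadow: write `f = ∑_{m ≤ deg f} f_m` in homogeneous components
(`MvPolynomial.sum_homogeneousComponent`); each `A · f_m` is a form of degree `m`, hence has total
degree `≤ m ≤ deg f` (`MvPolynomial.IsHomogeneous.totalDegree_le`), and the total degree of a
finite sum is at most the maximum over the summands (`MvPolynomial.totalDegree_finsetSum_le`).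

## References

* J. M. Landsberg, *Geometry and Complexity Theory*, Cambridge Studies in Advanced Mathematics
  169, CUP 2017, §1.2.5 (key `Landsberg2017`).
-/

namespace Literature.Computability.AlgebraicComplexity

open MvPolynomial

variable {σ k : Type*} [Fintype σ] [CommRing k]

/-- **Discharge of `totalDegree_linSubst_le`.** A linear substitution of variables does not raise
the total degree: `deg (A · f) ≤ deg f` for every square matrix `A` and every polynomial `f`.
Inhomogeneous shadow of "`End(ℂ^N)` acts on `Sⁿℂ^N` by `L · p(x) := p(Lᵀ x)`"
(Landsberg 2017 §1.2.5): decompose `f` into homogeneous components, each of which is sent to a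
form of the same degree (`linSubst_isHomogeneous`). Holds over any commutative ring `k`.
[cite: Landsberg2017, §1.2.5] -/
theorem totalDegree_linSubst_le_holds : totalDegree_linSubst_le (σ := σ) (k := k) := by
  intro A f
  calc (linSubst σ k A f).totalDegree
      = (∑ m ∈ Finset.range (f.totalDegree + 1),
          linSubst σ k A (homogeneousComponent m f)).totalDegree := by
        rw [← map_sum, sum_homogeneousComponent]
    _ ≤ f.totalDegree := totalDegree_finsetSum_le fun m hm =>
        (linSubst_isHomogeneous A (homogeneousComponent_isHomogeneous m f)).totalDegree_le.trans
          (Nat.lt_succ_iff.mp (Finset.mem_range.mp hm))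

end Literature.Computability.AlgebraicComplexity
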